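import Summits.HodgeConjecture.CorCM.Census.CyclicCharacterFibreLaw

/-!
# Cyclic characters, IV: the block count of the odd-kernel class in CLOSED FORM — `β·|G| = Σ_{d ∣ |N|} φ(d)·2^{|G|/(2d)}` for a cyclic kernel `N`

COR-CM (cell `pub-hodgecm2`), count-neutral kernel combinatorics by the binder seat b09 (gen 41; lane CYCLIC-CHARACTER FIBRE LAW, part VI), on part II
(`Census/CyclicCharacterFibreLaw.card_block_mul_card_of_odd`: Burnside over the odd kernel) and Mathlibʼs `IsCyclic.card_orderOf_eq_totient`, BY NAME, in the
style of b09 gen 28ʼs `Census/BlockParityBurnsideCyclic.lean`.  Theorems only (no definition, no `decide`, no certificate, no named fact, no `sorry`).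
HONEST FRAMING: `HC_CM` is NOT proved, here or anywhere in the tree; nothing here is a period or a headline.

* §1 `|G| = 2ᵏ · |ker w|` for an onto additive `w : G → ℤ/2ᵏ` (`card_eq_two_pow_mul_card_ker`).
* §2 a sum over a CYCLIC subgroup regrouped by element orders (`sum_subgroup_eq_sum_divisors`: `Σ_{g ∈ N} f(ord g) = Σ_{d ∣ |N|} φ(d) f(d)`).
* §3 **THE METACYCLIC BLOCK COUNT** (`card_block_mul_card_of_cyclic_ker`): for `(G, c, w)` of the odd-kernel class with CYCLIC kernel `N` of (odd) order `m`
  (`G ≅ ℤ/m ⋊ ℤ/2ᵏ`, ANY action; `|G| = 2ᵏ m`): **`β(G, c) · |G| = Σ_{d ∣ m} φ(d) · 2^{|G|/(2d)}`**, and with the odd-kernel law of part II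
  **`(φ₂(G, c) + 1) · |G| = Σ_{d ∣ m} φ(d) · 2^{|G|/(2d)}`** (`fibreTwo_add_one_mul_card_of_cyclic_ker`).  E.g. `ℤ/3 ⋊ ℤ/8`: `24 β = 2¹² + 2·2⁴ = 4128`,
  `β = 172`, `φ₂ = 171` (gen 40ʼs numerics); `ℤ/5 ⋊ ℤ/8`: `40 β = 2²⁰ + 4·2⁴`, `β = 26216`; `ℤ/3 ⋊ ℤ/16`: `48 β = 2²⁴ + 2·2⁸`, `β = 349536`.

## References
* [Pohlmann1968] H. Pohlmann, Algebraic cycles on abelian varieties of complex multiplication type, Ann. of Math. 88 (1968), Thm 1.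
* [Milne1999] J. S. Milne, Lefschetz motives and the Tate conjecture, Compositio Math. 117 (1999), Prop. 2.1, p. 54.
-/

namespace Summit.HodgeConjecture.CorCM.Census.CyclicCharacter

open Finset
open Summit.HodgeConjecture.CorCM.Prior.AllgGroup.RfwfAllgGroup
open Summit.HodgeConjecture.CorCM.Census.BlockParity
open Summit.HodgeConjecture.CorCM.Census.Coinvariant

section BlockCount

variable {G : Type*} [Group G] [Fintype G] [DecidableEq G] {k : ℕ} {w : G → ZMod (2 ^ k)} {c : G}

/-! ## §1 The order of `G`: `|G| = 2ᵏ · |ker w|` -/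

omit [Fintype G] [DecidableEq G] in
/-- **`|G| = 2ᵏ · |ker w|`** for an onto additive `w : G → ℤ/2ᵏ` (the fibres of `w` are cosets of the kernel; any finite `G`). [folklore] -/
theorem card_eq_two_pow_mul_card_ker (hw : ∀ P Q : G, w (P * Q) = w P + w Q) (h1 : ∃ g₁ : G, w g₁ = 1)
    {K : Subgroup G} (hK : ∀ g : G, g ∈ K ↔ w g = 0) : Nat.card G = 2 ^ k * Nat.card K := by
  haveI : NeZero (2 ^ k) := ⟨pow_ne_zero _ two_ne_zero⟩
  -- the bundled homomorphism
  set f : G →* Multiplicative (ZMod (2 ^ k)) :=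
    { toFun := fun g => Multiplicative.ofAdd (w g)
      map_one' := by rw [map_one hw, ofAdd_zero]
      map_mul' := fun a b => by rw [hw, ofAdd_add] } with hf
  have hker : f.ker = K := by
    ext g
    rw [MonoidHom.mem_ker, hK]
    change Multiplicative.ofAdd (w g) = 1 ↔ w g = 0
    rw [← ofAdd_zero, Multiplicative.ofAdd.injective.eq_iff]
  have hsurj : Function.Surjective f := by
    obtain ⟨g₁, hg₁⟩ := h1
    intro t
    refine ⟨g₁ ^ (Multiplicative.toAdd t).val, ?_⟩
    change Multiplicative.ofAdd (w (g₁ ^ (Multiplicative.toAdd t).val)) = t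
    rw [map_pow hw, hg₁, nsmul_eq_mul, mul_one, ZMod.natCast_zmod_val, ofAdd_toAdd]
  have hidx : K.index = 2 ^ k := by
    rw [← hker, Subgroup.index_ker, MonoidHom.range_eq_top.mpr hsurj, Subgroup.card_top, Nat.card_eq_fintype_card, Fintype.card_multiplicative,
      ZMod.card]
  rw [← Subgroup.index_mul_card K, hidx]

/-! ## §2 Sums over a cyclic subgroup, by element orders -/

omit [Fintype G] [DecidableEq G] in
/-- **A sum over a CYCLIC subgroup regrouped by orders**: `Σ_{g ∈ N} f(ord g) = Σ_{d ∣ |N|} φ(d)·f(d)`. [folklore] -/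
theorem sum_subgroup_eq_sum_divisors (N : Subgroup G) [Fintype N] [IsCyclic N] (f : ℕ → ℕ) :
    ∑ x : N, f (orderOf (x : G)) = ∑ d ∈ (Nat.card N).divisors, Nat.totient d * f d := by
  classical
  have horb : ∀ x : N, f (orderOf (x : G)) = (fun d => f d) (orderOf x) := fun x => by rw [Subgroup.orderOf_coe]
  rw [Finset.sum_congr rfl (fun x _ => horb x), Nat.card_eq_fintype_card,
    ← Finset.sum_fiberwise_of_maps_to' (s := (univ : Finset N)) (t := (Fintype.card N).divisors) (g := fun x : N => orderOf x)
      (fun x _ => Nat.mem_divisors.mpr ⟨orderOf_dvd_card, Fintype.card_ne_zero⟩) (fun d => f d)]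
  refine Finset.sum_congr rfl fun d hd => ?_
  rw [Finset.sum_const, smul_eq_mul, IsCyclic.card_orderOf_eq_totient (Nat.mem_divisors.mp hd).1]

/-! ## §3 The block count of the odd-kernel class with cyclic kernel -/

/-- **THE METACYCLIC BLOCK COUNT: `β(G, c) · |G| = Σ_{d ∣ |N|} φ(d) · 2^{|G|/(2d)}`** for a cyclic odd kernel `N = ker w` (`G ≅ ℤ/m ⋊ ℤ/2ᵏ`, any action,
`c` central with `w c ≠ 0`). [folklore] -/
theorem card_block_mul_card_of_cyclic_ker (hw : ∀ P Q : G, w (P * Q) = w P + w Q) (hk : 1 ≤ k) (hc2 : c * c = 1)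
    (hcen : ∀ x : G, x * c = c * x) (hwc : w c ≠ 0) {N : Subgroup G} (hN : ∀ g : G, g ∈ N ↔ w g = 0) [IsCyclic N] (hodd : Odd (Nat.card N)) :
    Fintype.card (Block c) * Fintype.card G = ∑ d ∈ (Nat.card N).divisors, Nat.totient d * 2 ^ (Fintype.card G / 2 / d) := by
  classical
  haveI : Fintype N := Fintype.ofFinite N
  have hodd' : ∀ g : G, w g = 0 → Odd (orderOf g) := fun g hg =>
    hodd.of_dvd_nat (Subgroup.orderOf_dvd_natCard N ((hN g).mpr hg))
  rw [card_block_mul_card_of_odd hw hk hc2 hcen hwc hodd', ← sum_subgroup_eq_sum_divisors N (fun d => 2 ^ (Fintype.card G / 2 / d)),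
    ← Finset.sum_filter, Finset.sum_subtype ((univ : Finset G).filter (fun g => w g = 0)) (p := (· ∈ N))
      (fun g => by rw [Finset.mem_filter, hN g]; exact ⟨fun h => h.2, fun h => ⟨Finset.mem_univ _, h⟩⟩)]
  refine Finset.sum_congr rfl fun x _ => ?_
  rw [Nat.div_div_eq_div_mul, Nat.div_div_eq_div_mul, mul_comm]

/-- **`(φ₂(G, c) + 1) · |G| = Σ_{d ∣ |N|} φ(d) · 2^{|G|/(2d)}`** for a cyclic odd kernel (`k ≥ 2`): the metacyclic columnʼs coinvariant fibre in closed form.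
[folklore] -/
theorem fibreTwo_add_one_mul_card_of_cyclic_ker (hw : ∀ P Q : G, w (P * Q) = w P + w Q) (hk : 2 ≤ k) (h1 : ∃ g₁ : G, w g₁ = 1) (hc2 : c * c = 1)
    (hcen : ∀ x : G, x * c = c * x) (hwc : w c ≠ 0) {N : Subgroup G} (hN : ∀ g : G, g ∈ N ↔ w g = 0) [IsCyclic N] (hodd : Odd (Nat.card N)) :
    (fibreTwo c hc2 + 1) * Fintype.card G = ∑ d ∈ (Nat.card N).divisors, Nat.totient d * 2 ^ (Fintype.card G / 2 / d) := by
  have hodd' : ∀ g : G, w g = 0 → Odd (orderOf g) := fun g hg =>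
    hodd.of_dvd_nat (Subgroup.orderOf_dvd_natCard N ((hN g).mpr hg))
  rw [fibreTwo_add_one_eq_card_block_of_odd hw hk h1 hc2 hcen hwc hodd']
  exact card_block_mul_card_of_cyclic_ker hw (by omega) hc2 hcen hwc hN hodd

omit [DecidableEq G] in
/-- **The order of an odd-kernel group: `|G| = 2ᵏ · |N|`**, so `|G|/(2d) = 2ᵏ⁻¹·|N|/d` in the block count. [folklore] -/
theorem card_eq_two_pow_mul_card_ker' (hw : ∀ P Q : G, w (P * Q) = w P + w Q) (h1 : ∃ g₁ : G, w g₁ = 1)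
    {N : Subgroup G} (hN : ∀ g : G, g ∈ N ↔ w g = 0) : Fintype.card G = 2 ^ k * Nat.card N := by
  rw [← Nat.card_eq_fintype_card]
  exact card_eq_two_pow_mul_card_ker hw h1 hN

end BlockCount

end Summit.HodgeConjecture.CorCM.Census.CyclicCharacter
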